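import Summits.CriticalPhenomena.CardyFormulaZ2.Theorems.CardyMeckeFlipLawToCrossingsLower
import Literature.Probability.Percolation.QuadCrossingDuality
import Literature.Probability.Percolation.DualFaceChains
import Literature.Probability.Percolation.PlanarDuality
import HarnessLib

/-!
# If the harder quad of `R` is not crossed, the dual configuration crosses an easier transposed quad

Support file for item `LawToCrossings` (stmt-CriticalPhenomena-14828) of route `CardyMeckeFlip`,
sub-problem `CardyFormulaZ2`: second step of the LOWER half of the bridge (planar duality).

Let `Φ` be a square model of `R`, `H = rotI.trans Φ`, and `Q⁺ = rectQuad H (1+s) (1-s)` the harder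
quad (in the coordinates of `Φ` it is the rectangle `[-(1-s), 1-s] × [-(1+s), 1+s]`).  The
transposed quads `rectQuad Φ a b = Φ([-a, a] × [-b, b])` are crossed from left to right; for
`a < 1 < b` they are EASIER than the transposed quad `rectQuad Φ 1 1` of `R`.

* `not_crossed_subset_dual_crossed` — **for `δ < δ₀(R, s, r)`: if `Q⁺ ∉ S_ω` then the dual
  configuration `dualConfig ω`, drawn on `δℤ²` (faces indexed by their lower-left corners), crosses
  the transposed quad `rectQuad Φ ((1-s)(1-r)) ((1+s)(1+r))`** — no open crossing of `Q⁺` gives a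
  path in `[Q⁺]` from its right to its left side off the open edges (`Quad.exists_path_avoiding_…`,
  continuum duality), shadowed by a dual-open chain of faces (`exists_dualConfig_openConnIn_of_path`)
  whose drawn polyline, read through `(scaleXY (1-s) (1+s) ≫ Φ)⁻¹`, is a continuum in the band
  `|Im| ≤ 1 + η` joining the two far sides, hence contains a crossing of `[-(1-r), 1-r] × [-(1+r), 1+r]`;
* `prob_not_crossed_le_z2QuadLaw` — hence `P_{1/2}[Q⁺ ∉ S_ω] ≤ μ_δ(⊞_{rectQuad Φ ((1-s)(1-r)) ((1+s)(1+r))})`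
  (the law of `dualConfig ω` under `P_{1/2}` is `P_{1/2}`, `bondPercolation_map_dualConfig_holds`).

References: O. Schramm, S. Smirnov, Ann. Probab. 39 (2011), proof of Lemma 6.1 (duality with
continuum paths); G. Grimmett, *Percolation* (1999), §11.2.
-/

noncomputable section

open Set Filter MeasureTheory Metric Complex
open scoped Topology unitInterval ENNReal
open Literature.Probability.Percolation Literature.Probability.Percolation.QuadCrossing
open Literature.Probability.RandomPlanarGeometry Literature.Probability.LatticeModels
open Literature.Topology.PlaneTopology

namespace Summit.CriticalPhenomena.CardyFormulaZ2.Theorems.MeckeFlipBridge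

/-! ### The coordinate scaling `scaleXY` -/

/-- `scaleXY c d` in coordinates. -/
theorem scaleXY_apply_re_im {c d : ℝ} (hc : c ≠ 0) (hd : d ≠ 0) (z : ℂ) :
    (Quad.scaleXY c d hc hd z).re = c * z.re ∧ (Quad.scaleXY c d hc hd z).im = d * z.im :=
  Quad.re_im_ofReal_add_ofReal_mul_I _ _

/-- `(scaleXY c d)⁻¹` in coordinates. -/
theorem scaleXY_symm_apply_re_im {c d : ℝ} (hc : c ≠ 0) (hd : d ≠ 0) (z : ℂ) :
    ((Quad.scaleXY c d hc hd).symm z).re = z.re / c ∧ ((Quad.scaleXY c d hc hd).symm z).im = z.im / d :=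
  Quad.re_im_ofReal_add_ofReal_mul_I _ _

/-- The transposed quads through the rescaled chart: for `Φ' = (scaleXY c d).trans Φ`,
`rectQuad Φ' a b = rectQuad Φ (c a) (d b)`. -/
theorem rectQuad_scaleXY_trans (Φ : ℂ ≃ₜ ℂ) {c d a b : ℝ} (hc : 0 < c) (hd : 0 < d) (ha : 0 < a)
    (hb : 0 < b) :
    Quad.rectQuad ((Quad.scaleXY c d hc.ne' hd.ne').trans Φ) a b ha hb (fun _ => mem_univ _) =
      Quad.rectQuad (D := (univ : Set ℂ)) Φ (c * a) (d * b) (mul_pos hc ha) (mul_pos hd hb)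
        (fun _ => mem_univ _) := by
  apply Quad.ext
  intro p
  change Φ (Quad.scaleXY c d hc.ne' hd.ne' (Quad.rectMap a b p)) = Φ (Quad.rectMap (c * a) (d * b) p)
  rw [Quad.scaleXY_rectMap]

/-! ### Duality: the transposed easier quad is crossed by the dual configuration -/

/-- **If the harder quad `Q⁺ = rectQuad H (1+s) (1-s)` (`H = rotI.trans Φ`) is not crossed, the dual
configuration crosses the transposed easier quad `rectQuad Φ ((1-s)(1-r)) ((1+s)(1+r))`, for small
mesh** (a statement about the plane homeomorphism `Φ` alone; for a square model `Φ` of `R` these are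
the harder quad of `R` and an easier transposed quad of `R`). -/
theorem not_crossed_subset_dual_crossed (Φ : ℂ ≃ₜ ℂ) {s r : ℝ} (hs : 0 < s) (hs' : s ≤ 1 / 2)
    (hr : 0 < r) (hr' : r ≤ 1 / 2) :
    ∃ δ₀ : ℝ, 0 < δ₀ ∧ ∀ δ : ℝ, 0 < δ → δ < δ₀ → ∀ ω : BondConfig (Site 2),
      Quad.rectQuad ((Homeomorph.mulLeft₀ Complex.I Complex.I_ne_zero).trans Φ) (1 + s) (1 - s)
        (by linarith) (by linarith) (fun _ => mem_univ _) ∉ z2QuadConfig univ δ ω →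
      Quad.rectQuad (D := (univ : Set ℂ)) Φ ((1 - s) * (1 - r)) ((1 + s) * (1 + r))
        (mul_pos (by linarith) (by linarith)) (mul_pos (by linarith) (by linarith))
        (fun _ => mem_univ _) ∈ z2QuadConfig univ δ (dualConfig ω) := by
  have h1s : (0 : ℝ) < 1 - s := by linarith
  have h1s' : (0 : ℝ) < 1 + s := by linarith
  set H : ℂ ≃ₜ ℂ := (Homeomorph.mulLeft₀ Complex.I Complex.I_ne_zero).trans Φ with hH
  set L : ℂ ≃ₜ ℂ := Quad.scaleXY (1 - s) (1 + s) h1s.ne' h1s'.ne' with hL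
  set Φ' : ℂ ≃ₜ ℂ := L.trans Φ with hΦ'
  -- reading a point `Φ w` of the plane through `Φ'⁻¹`
  have hread : ∀ w : ℂ, (Φ'.symm (Φ w)).re = w.re / (1 - s) ∧ (Φ'.symm (Φ w)).im = w.im / (1 + s) := by
    intro w
    have : Φ'.symm (Φ w) = L.symm w := by
      rw [hΦ', Homeomorph.symm_trans_apply, Homeomorph.symm_apply_apply]
    rw [this]
    exact scaleXY_symm_apply_re_im h1s.ne' h1s'.ne' w
  -- tolerance and uniform continuity of `Φ'⁻¹` near `[Q⁺]`
  set η : ℝ := r / 8 with hη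
  have hηpos : 0 < η := by positivity
  have hηr : 4 * η < r := by rw [hη]; linarith
  have hη1 : η < 1 := by rw [hη]; linarith
  set C : Set ℂ := Φ '' (Icc (-(1 - s)) (1 - s) ×ℂ Icc (-(1 + s)) (1 + s)) with hC
  have hCc : IsCompact C := (isCompact_Icc.reProdIm isCompact_Icc).image Φ.continuous
  obtain ⟨θ, hθ, -, hUC⟩ := exists_forall_dist_symm_lt Φ' hCc hηpos
  have hCread : ∀ q ∈ C, Φ'.symm q ∈ Icc (-1 : ℝ) 1 ×ℂ Icc (-1 : ℝ) 1 := by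
    rintro _ ⟨w, hw, rfl⟩
    rw [mem_reProdIm, mem_Icc, mem_Icc] at hw
    rw [mem_reProdIm, (hread w).1, (hread w).2, mem_Icc, mem_Icc, le_div_iff₀ h1s,
      div_le_iff₀ h1s, le_div_iff₀ h1s', div_le_iff₀ h1s']
    exact ⟨⟨by linarith [hw.1.1], by linarith [hw.1.2]⟩, by linarith [hw.2.1], by linarith [hw.2.2]⟩
  refine ⟨θ / 3, by positivity, ?_⟩
  intro δ hδ hδlt ω hnot
  have hδθ : 3 * δ < θ := by linarith
  -- no open crossing of `Q⁺`
  have hnoc : ¬ ∃ K, (Quad.rectQuad H (1 + s) (1 - s) (by linarith) (by linarith)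
      (fun _ => mem_univ _)).IsCrossing K ∧ K ⊆ openEdgeUnion δ ω := by
    rintro ⟨K, hK, hKO⟩
    exact hnot (mem_z2QuadConfig_of_isCrossing hK hKO)
  -- the dual path off the open edges, from the right side to the left side of `[Q⁺]`
  obtain ⟨β, hβc, hβm, hβ0, hβ1, hβO⟩ := Quad.exists_path_avoiding_of_not_exists_isCrossing _ hδ hnoc
  have hcarr : (Quad.rectQuad H (1 + s) (1 - s) (by linarith) (by linarith)
      (fun _ => mem_univ _)).carrier = C := by
    rw [hC, hH, carrier_rq_rot]
  -- the dual-open chain of faces shadowing `β`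
  set S : Set (Site 2) := {u : Site 2 | ∃ t ∈ Icc (0 : ℝ) 1,
    β t ∈ Icc (δ * (u 0 : ℝ)) (δ * (u 0 : ℝ) + δ) ×ℂ Icc (δ * (u 1 : ℝ)) (δ * (u 1 : ℝ) + δ)} with hS
  obtain ⟨u, w, hu, hw, hconn⟩ := exists_dualConfig_openConnIn_of_path hδ hβc
    (fun t ht => (hβO t ht).1) (S := S) (fun u t ht hut => ⟨t, ht, hut⟩)
  obtain ⟨huS, hwS, hreach⟩ := hconn
  obtain ⟨W⟩ := hreach
  have hdualE : dualConfig ω ⊆ (zdGraph 2).edgeSet := fun e he => he.1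
  obtain ⟨L', hL'c, hL'conn, huL', hwL', hnear, hL'O⟩ := exists_polyline_of_walk hδ hdualE W
  -- every point of the polyline is within `3δ` of a point of `β`, i.e. of `C`
  have hnearC : ∀ z ∈ L', ∃ q ∈ C, dist z q < θ := by
    intro z hz
    obtain ⟨x, ⟨t, ht, hxt⟩, hxd⟩ := hnear z hz
    refine ⟨β t, hcarr ▸ hβm ht, ?_⟩
    calc dist z (β t) ≤ dist z (meshPoint δ x) + dist (meshPoint δ x) (β t) := dist_triangle _ _ _
      _ ≤ δ + 2 * δ := add_le_add hxd (dist_meshPoint_le_of_mem_face hδ hxt)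
      _ < θ := by linarith
  -- the two ends
  have huC : β 0 ∈ C := hcarr ▸ hβm ⟨le_rfl, zero_le_one⟩
  have hwC : β 1 ∈ C := hcarr ▸ hβm ⟨zero_le_one, le_rfl⟩
  have hu1 : (Φ'.symm (β 0)).re = 1 := by
    rw [hH, side_one_rq_rot] at hβ0
    obtain ⟨w₀, hw₀, hw₀e⟩ := hβ0
    rw [← hw₀e, (hread w₀).1, hw₀.1, div_self h1s.ne']
  have hw1 : (Φ'.symm (β 1)).re = -1 := by
    rw [hH, side_three_rq_rot] at hβ1
    obtain ⟨w₁, hw₁, hw₁e⟩ := hβ1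
    rw [← hw₁e, (hread w₁).1, hw₁.1, neg_div, div_self h1s.ne']
  have hdu : dist (meshPoint δ (u : Site 2)) (β 0) < θ :=
    (dist_meshPoint_le_of_mem_face hδ hu).trans_lt (by linarith)
  have hdw : dist (meshPoint δ (w : Site 2)) (β 1) < θ :=
    (dist_meshPoint_le_of_mem_face hδ hw).trans_lt (by linarith)
  have hure : 1 - η ≤ (Φ'.symm (meshPoint δ u)).re := by
    have hlt := hUC _ huC _ hdu
    have hre := (abs_re_le_norm (Φ'.symm (meshPoint δ u) - Φ'.symm (β 0))).trans_lt
      (by rwa [← dist_eq_norm])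
    rw [sub_re, hu1] at hre
    linarith [(abs_lt.1 hre).1]
  have hwre : (Φ'.symm (meshPoint δ w)).re ≤ -1 + η := by
    have hlt := hUC _ hwC _ hdw
    have hre := (abs_re_le_norm (Φ'.symm (meshPoint δ w) - Φ'.symm (β 1))).trans_lt
      (by rwa [← dist_eq_norm])
    rw [sub_re, hw1] at hre
    linarith [(abs_lt.1 hre).2]
  -- the polyline is not trivial
  have hL'O' : L' ⊆ openEdgeUnion δ (dualConfig ω) := by
    rcases hL'O with hL'O | hL'O
    · exfalso
      have hwu : meshPoint δ (w : Site 2) = meshPoint δ (u : Site 2) := by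
        have := hwL'; rw [hL'O] at this; exact mem_singleton_iff.1 this
      rw [hwu] at hwre
      linarith
    · exact hL'O
  -- read through `Φ'⁻¹` and apply the band lemma
  set K : Set ℂ := Φ'.symm '' L' with hK
  have hKc : IsCompact K := hL'c.image Φ'.symm.continuous
  have hKconn : IsConnected K := hL'conn.image _ Φ'.symm.continuous.continuousOn
  have hKim : ∀ v ∈ K, |v.im| ≤ 1 + η := by
    rintro _ ⟨z, hz, rfl⟩
    obtain ⟨q, hqC, hqd⟩ := hnearC z hz
    have hlt := hUC q hqC z hqd
    have hsq := hCread q hqC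
    rw [mem_reProdIm, mem_Icc, mem_Icc] at hsq
    have him := (abs_im_le_norm (Φ'.symm z - Φ'.symm q)).trans_lt (by rwa [← dist_eq_norm])
    rw [sub_im] at him
    exact abs_le.2 ⟨by linarith [(abs_lt.1 him).1, hsq.2.1], by linarith [(abs_lt.1 him).2, hsq.2.2]⟩
  have hK₀ : ∃ v ∈ K, v.re ≤ -1 + η := ⟨_, mem_image_of_mem _ hwL', hwre⟩
  have hK₂ : ∃ v ∈ K, 1 - η ≤ v.re := ⟨_, mem_image_of_mem _ huL', hure⟩
  obtain ⟨K', hK'K, hK'c, hK'conn, hK'sub, hK'0, hK'2⟩ :=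
    exists_subcontinuum_crossing (g := id) hr' hηpos hηr continuousOn_id (injOn_id _)
      (fun z _ => by simp [hηpos.le]) hKc hKconn hKim hK₀ hK₂
  rw [image_id] at hK'sub
  simp only [image_id] at hK'0 hK'2
  -- push forward by `Φ'`: a crossing of `rectQuad Φ' (1-r) (1+r) = rectQuad Φ ((1-s)(1-r)) ((1+s)(1+r))`
  rw [← rectQuad_scaleXY_trans Φ h1s h1s' (by linarith) (by linarith)]
  refine mem_z2QuadConfig_of_isCrossing (K := Φ' '' K') ⟨hK'c.image Φ'.continuous,
    hK'conn.image _ Φ'.continuous.continuousOn, ?_, ?_, ?_⟩ ?_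
  · rw [carrier_rq]
    exact image_mono hK'sub
  · obtain ⟨v, hvK', hv⟩ := hK'0
    refine ⟨Φ' v, mem_image_of_mem _ hvK', ?_⟩
    rw [side_zero_rq]
    refine mem_image_of_mem _ ⟨hv.2, ?_⟩
    have := hv.1
    rw [mem_reProdIm] at this
    exact this.2
  · obtain ⟨v, hvK', hv⟩ := hK'2
    refine ⟨Φ' v, mem_image_of_mem _ hvK', ?_⟩
    rw [side_two_rq]
    refine mem_image_of_mem _ ⟨hv.2, ?_⟩
    have := hv.1
    rw [mem_reProdIm] at this
    exact this.2
  · rintro _ ⟨v, hv, rfl⟩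
    obtain ⟨z, hz, hzv⟩ := hK'K hv
    rw [← hzv, Homeomorph.apply_symm_apply]
    exact hL'O' hz

/-- **Lower per-mesh inequality, dual side.**  For `s, r ∈ (0, 1/2]` and `0 < δ < δ₀(R, s, r)`,
`P_{1/2}[Q⁺ ∉ S_ω] ≤ μ_δ(⊞_{rectQuad Φ ((1-s)(1-r)) ((1+s)(1+r))})`: the dual configuration has law
`P_{1/2}` again (`bondPercolation_map_dualConfig_holds`), and its encoding in `ℋ_ℂ` has law `μ_δ`. -/
theorem prob_not_crossed_le_z2QuadLaw (Φ : ℂ ≃ₜ ℂ) {s r : ℝ} (hs : 0 < s) (hs' : s ≤ 1 / 2)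
    (hr : 0 < r) (hr' : r ≤ 1 / 2) :
    ∃ δ₀ : ℝ, 0 < δ₀ ∧ ∀ δ : ℝ, 0 < δ → δ < δ₀ →
      bondPercolation (zdGraph 2) half
        {ω | Quad.rectQuad ((Homeomorph.mulLeft₀ Complex.I Complex.I_ne_zero).trans Φ) (1 + s) (1 - s)
          (by linarith) (by linarith) (fun _ => mem_univ _) ∉ z2QuadConfig univ δ ω} ≤
      (z2QuadLaw (univ : Set ℂ) δ : Measure (QuadConfig (univ : Set ℂ)))
        (QuadConfig.crossedEvent (Quad.rectQuad (D := (univ : Set ℂ)) Φ ((1 - s) * (1 - r))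
          ((1 + s) * (1 + r)) (mul_pos (by linarith) (by linarith)) (mul_pos (by linarith) (by linarith))
          (fun _ => mem_univ _))) := by
  obtain ⟨δ₀, hδ₀, hincl⟩ := not_crossed_subset_dual_crossed Φ hs hs' hr hr'
  refine ⟨δ₀, hδ₀, fun δ hδ hδlt => ?_⟩
  set Qt := Quad.rectQuad (D := (univ : Set ℂ)) Φ ((1 - s) * (1 - r)) ((1 + s) * (1 + r))
    (mul_pos (by linarith) (by linarith)) (mul_pos (by linarith) (by linarith)) (fun _ => mem_univ _)
    with hQt
  have hsymm : unitInterval.symm half = half := Subtype.ext (by simp [half]; norm_num)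
  calc bondPercolation (zdGraph 2) half
        {ω | Quad.rectQuad ((Homeomorph.mulLeft₀ Complex.I Complex.I_ne_zero).trans Φ) (1 + s) (1 - s)
          (by linarith) (by linarith) (fun _ => mem_univ _) ∉ z2QuadConfig univ δ ω}
      ≤ bondPercolation (zdGraph 2) half (dualConfig ⁻¹' {ω' | Qt ∈ z2QuadConfig univ δ ω'}) :=
        measure_mono fun ω hω => hincl δ hδ hδlt ω hω
    _ ≤ ((bondPercolation (zdGraph 2) half).map dualConfig) {ω' | Qt ∈ z2QuadConfig univ δ ω'} :=
        Measure.le_map_apply measurable_dualConfig.aemeasurable _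
    _ = bondPercolation (zdGraph 2) half {ω' | Qt ∈ z2QuadConfig univ δ ω'} := by
        rw [bondPercolation_map_dualConfig_holds half, hsymm]
    _ = (z2QuadLaw (univ : Set ℂ) δ : Measure (QuadConfig (univ : Set ℂ))) (QuadConfig.crossedEvent Qt) := by
        rw [z2QuadLaw_apply isOpen_univ hδ (QuadConfig.measurableSet_crossedEvent _)]
        rfl

end Summit.CriticalPhenomena.CardyFormulaZ2.Theorems.MeckeFlipBridge

end
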